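import Summits.NavierStokesRegularity.NavierStokesRegularity.Theses.AxisymmetricExtremality
import Summits.NavierStokesRegularity.NavierStokesRegularity.Theorems.AxisymmetricExtremalityPFoldToAxisymmetric
import Literature.Analysis.FluidPDE.KatoMaximalTime

/-!
# Strategist s20-g15 scratch — `AxisymmetricKatoGlobal` (stmt-NavierStokesRegularity-15453)

Typed forms of the census attempts (STRATEGY-CENSUS-s20-g15.md):

* `NoAxisymMinimalBlowup` — the threshold instance W_thr, the weakest statement `closes` consumes;
  `closes_of_thr` (it suffices), `thr_of_AXH` (it is formally weaker), `summit_of_thr_and_pfold`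
  (relative to the open sister crux it already gives the summit: costume check).
* `AprioriWeakL3` / `WeakL3Continuation` — the best "criterion + a-priori estimate" split
  (Ożański–Palasek 2023 criterion); `AXH_of_weakL3_split` is the (trivial) assembly.
Nothing here is proposed to the tree; no `sorry`.
-/

set_option linter.dupNamespace false

noncomputable section

open MeasureTheory Set Function
open scoped ENNReal

namespace Summit.NavierStokesRegularity.NavierStokesRegularity.Cruxes.AxisymmetricKatoGlobal.StrategistS20g15

open Summit.NavierStokesRegularity.NavierStokesRegularity.Theses.AxisymmetricExtremality
open Literature.Analysis.FluidPDE Literature.Analysis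

local notation "ℝ³" => EuclideanSpace ℝ (Fin 3)
local notation "ℂ³" => EuclideanSpace ℂ (Fin 3)

/-- The route's unfolded axisymmetry clause (verbatim from `AxisymmetricKatoGlobal`). -/
def AxisymClause (u₀ : ℝ³ → ℝ³) : Prop :=
  ∀ (θ : ℝ) (x : ℝ³), u₀ (WithLp.toLp 2 ![Real.cos θ * x 0 - Real.sin θ * x 1,
    Real.sin θ * x 0 + Real.cos θ * x 1, x 2]) = WithLp.toLp 2 ![Real.cos θ * u₀ x 0 -
    Real.sin θ * u₀ x 1, Real.sin θ * u₀ x 0 + Real.cos θ * u₀ x 1, u₀ x 2]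

/-- **W_thr** — the threshold instance: no axisymmetric `Ḣ^{1/2}`-minimal blow-up datum. This is
literally all that `closes` consumes of AX_H. -/
def NoAxisymMinimalBlowup : Prop :=
  ∀ ν : ℝ, 0 < ν → ∀ (u₀ : ℝ³ → ℝ³) (g : FunctionSpaces.HomSobolev ℝ³ ℂ³ (1 / 2 : ℝ)),
    IsMinimalBlowupDatum ν u₀ g → AxisymClause u₀ → False

/-- W_thr suffices in place of AX_H (same logic as the route's `closes`). -/
theorem closes_of_thr (h₂ : MinimalDatumPFold) (h₄ : PFoldToAxisymmetric)
    (hW : NoAxisymMinimalBlowup) : NavierStokesRegularity := by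
  show Literature.NS.NavierStokesExistenceSmoothR3
  intro ν hν u₀ hsm hdiv hdec
  by_contra hno
  obtain ⟨u₁, g, hmin, hax⟩ := h₄ ν hν (h₂ ν hν ⟨u₀, hsm, hdiv, hdec, hno⟩)
  exact hW ν hν u₁ g hmin hax

/-- W_thr is formally weaker than the crux. -/
theorem thr_of_AXH (h₃ : AxisymmetricKatoGlobal) : NoAxisymMinimalBlowup := by
  intro ν hν u₁ g hmin hax
  obtain ⟨hL3, hrep, hdiv₁, -, hnot⟩ := hmin
  exact hnot (h₃ ν hν u₁ g hL3 hrep hdiv₁ hax)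

/-- Costume check: relative to the OPEN sister crux `MinimalDatumPFold` (and the PROVED
`PFoldToAxisymmetric`), W_thr already gives the summit — so as a replacement crux it is
summit-strength modulo the route's other open item. -/
theorem summit_of_thr_and_pfold (h₂ : MinimalDatumPFold) (hW : NoAxisymMinimalBlowup) :
    NavierStokesRegularity :=
  closes_of_thr h₂ Theorems.axisymmetricExtremality_pFoldToAxisymmetric_proof hW

/-- Trivial half of the converse (no PDE): if there is no minimal blow-up datum at all (which the
summit implies along the landed Kato→Clay chain, ρ_max = ∞), then W_thr holds vacuously. -/
theorem thr_of_noMinimalData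
    (h : ∀ ν : ℝ, 0 < ν → ∀ (u₀ : ℝ³ → ℝ³) (g : FunctionSpaces.HomSobolev ℝ³ ℂ³ (1 / 2 : ℝ)),
      ¬ IsMinimalBlowupDatum ν u₀ g) : NoAxisymMinimalBlowup :=
  fun ν hν u₀ g hmin _ => h ν hν u₀ g hmin

/-! ## The best "criterion + a-priori estimate" split (Ożański–Palasek, Annals of PDE 9 (2023) =
arXiv:2210.10030, Thm 1.1: `L^∞_t L^{3,∞}_x` ⇒ quantitative regularity for axisymmetric classical
solutions). Weak-L³ is written with the distribution function in `ℝ≥0∞` (no `toReal` junk). -/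

/-- Uniform weak-`L³` bound of the slices `u t`, `t ∈ (0,T)`. -/
def WeakL3BoundOn (T : ℝ) (u : ℝ → ℝ³ → ℝ³) : Prop :=
  ∃ M : ℝ, ∀ t ∈ Ioo 0 T, ∀ lam : ℝ, 0 < lam →
    ENNReal.ofReal (lam ^ 3) * volume {x : ℝ³ | lam < ‖u t x‖} ≤ ENNReal.ofReal M

/-- **P1 (a priori)** — every local Kato solution from axisymmetric `L³ ∩ Ḣ^{1/2}` data stays
bounded in weak-`L³` up to its existence time. -/
def AprioriWeakL3 : Prop :=
  ∀ ν T : ℝ, 0 < ν → 0 < T → ∀ (u₀ : ℝ³ → ℝ³) (g : FunctionSpaces.HomSobolev ℝ³ ℂ³ (1 / 2 : ℝ))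
    (u : ℝ → ℝ³ → ℝ³), MemLp u₀ 3 volume → g.Represents (FunctionSpaces.EuclideanSpace.complexify ∘ u₀) →
    IsWeaklyDivFree u₀ → AxisymClause u₀ → IsKatoSolutionOn T ν u₀ u → WeakL3BoundOn T u

/-- **P2 (criterion, printed up to packaging)** — Ożański–Palasek Thm 1.1 + Kato local theory +
continuation (`IsKatoSolutionOn.continuation_of_bounded`): if every local Kato solution from the
datum is weak-`L³` bounded on its interval, the datum has a global Kato solution. -/
def WeakL3Continuation : Prop :=
  ∀ ν : ℝ, 0 < ν → ∀ (u₀ : ℝ³ → ℝ³) (g : FunctionSpaces.HomSobolev ℝ³ ℂ³ (1 / 2 : ℝ)),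
    MemLp u₀ 3 volume → g.Represents (FunctionSpaces.EuclideanSpace.complexify ∘ u₀) →
    IsWeaklyDivFree u₀ → AxisymClause u₀ →
    (∀ (T : ℝ) (u : ℝ → ℝ³ → ℝ³), 0 < T → IsKatoSolutionOn T ν u₀ u → WeakL3BoundOn T u) →
    HasGlobalKatoSolution ν u₀

/-- The assembly of the split is trivial logic; all difficulty sits in P1. -/
theorem AXH_of_weakL3_split (h₁ : AprioriWeakL3) (h₂ : WeakL3Continuation) :
    AxisymmetricKatoGlobal := by
  intro ν hν u₀ g hL3 hrep hdiv hax
  exact h₂ ν hν u₀ g hL3 hrep hdiv hax (fun T u hT hu => h₁ ν T hν hT u₀ g u hL3 hrep hdiv hax hu)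

end Summit.NavierStokesRegularity.NavierStokesRegularity.Cruxes.AxisymmetricKatoGlobal.StrategistS20g15

end
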